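import Summits.QuantumFields.YangMills.Theorems.PoincareLipschitzUniformSmallScaleEnergyOfTangentMaps
import Literature.Analysis.PDE.HarmonicMapMinimisers
import HarnessLib

/-!
# S1″ from two named facts: compactness (Luckhaus∕Simon) and the tangent-map Liouville row (Schoen–Uhlenbeck Prop. 1.2)

Cell `ym3-torus`, LINE 25 «CompactnessTransfer» on `Summit.QuantumFields.YangMills.Theses.PoincareLipschitz.BlockLipschitzL`
(crux stmt-QuantumFields-23533; downstream `…UnitScaleTilt.HistoryTailL`, stmt-QuantumFields-19936), continuum stub S1″
`stub_uniformSmallScaleEnergy` (registered v1.4-band text).  This file is a ONE-LINE DOOR: it instantiates the (TM) re-cut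
✓`…Theorems.PoincareLipschitzUniformSmallScaleEnergyOfTangentMaps.uniformSmallScaleEnergy_band_of_compactness_tangentMaps (hCpt) (hTM)`
(seat px3 g9: monotonicity ✓`hMono_holds`, dilation, the monotonicity equality, blow-up to a tangent map, zero density) at the two
NAMED Literature facts whose bodies are those binders token for token:

* `Literature.Analysis.PDE.MinimisingMapCompactness` — compactness of energy minimising maps `Q → S³` [Simon1996 §2.9 Lemma 1;
  Luckhaus 1988];
* `Literature.Analysis.PDE.MinimisingTangentMapConstant` — a radially constant map of the minimising class is constant
  [SchoenUhlenbeck1984, Proposition 1.2 (p. 90)].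

So the registered S1″ text follows from `(hC) (hT)` — two named facts, no interior-regularity (`MinimisingMapSmoothness`) and no
ε-regularity anywhere on this road.

HONEST: nothing new is proved here — a composition by `exact`; (C) and (TM) are HYPOTHESES (printed theorems, vended as named
facts per D-0014; the cell is discharging (C) — seat w2 g13's `minimisingMapCompactness_holds` — and caps the density of tangent
maps at `3π` — seat px3 g9's (TM-F); the `8π` gap of [SU84 Lemma 1.1] stays named); S1″ is therefore CONDITIONAL on them;
`BlockLipschitzL`, `HistoryTailL`, K1, `MeanDeviationL` are NOT proved here; YM₃ on the unit torus `T³` is rung R3 of the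
cell's ladder — NOT `d = 4`, NOT infinite volume, NOT a mass gap, NOT the Clay problem.
-/

noncomputable section

open scoped BigOperators Topology
open MeasureTheory Set Filter Metric

namespace Summit.QuantumFields.YangMills.Theorems.PoincareLipschitzUniformSmallScaleEnergyOfTangentMapFact

open Literature.Analysis.FunctionSpaces (HasWeakFDerivOn)
open Summit.QuantumFields.YangMills.Theorems.PoincareLipschitzUniformSmallScaleEnergyOfTangentMaps
  (uniformSmallScaleEnergy_band_of_compactness_tangentMaps zeroDensity_of_compactness_tangentMaps)

/-- ★★ **(ZD) FROM THE TWO NAMED FACTS**: every cube-minimiser of the class has ZERO DENSITY AT THE ORIGIN —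
`inf_{0<ρ<1} ρ⁻¹ ∫_{B_ρ(0)} Σᵢ‖G eᵢ‖² = 0`, in the `∀ η > 0, ∃ ρ ∈ (0,1)` form of ✓`zeroDensity_of_compactness_tangentMaps` (its tangent maps
at `0` — blow-up limits, which exist by (C) — are radially constant by the monotonicity equality, hence constant by (TM)).
[cite: Simon1996, §2.4, §2.9 Lemma 1, §3.1; SchoenUhlenbeck1984, Proposition 1.2 (p. 90)] -/
theorem zeroDensity_of_compactness_tangentMapFact (hC : Literature.Analysis.PDE.MinimisingMapCompactness)
    (hT : Literature.Analysis.PDE.MinimisingTangentMapConstant) :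
    ∀ (hQ : IsOpen {x : EuclideanSpace ℝ (Fin 3) | ∀ i : Fin 3, |x i| < 1}) (U : EuclideanSpace ℝ (Fin 3) → EuclideanSpace ℝ (Fin 4)) (G : EuclideanSpace ℝ (Fin 3) → (EuclideanSpace ℝ (Fin 3) →L[ℝ] EuclideanSpace ℝ (Fin 4))),
      (HasWeakFDerivOn ⟨{x : EuclideanSpace ℝ (Fin 3) | ∀ i : Fin 3, |x i| < 1}, hQ⟩ volume U G ∧
        (∀ x : EuclideanSpace ℝ (Fin 3), (∀ i : Fin 3, |x i| < 1) → ‖U x‖ = 1) ∧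
        IntegrableOn (fun x => ∑ i : Fin 3, ‖G x (EuclideanSpace.single i (1:ℝ))‖ ^ 2) {x : EuclideanSpace ℝ (Fin 3) | ∀ i : Fin 3, |x i| < 1} ∧
        (∀ (y : EuclideanSpace ℝ (Fin 3)) (ρ : ℝ), 0 < ρ → closedBall y ρ ⊆ {x : EuclideanSpace ℝ (Fin 3) | ∀ i : Fin 3, |x i| < 1} →
          ∀ (W : EuclideanSpace ℝ (Fin 3) → EuclideanSpace ℝ (Fin 4)) (GW : EuclideanSpace ℝ (Fin 3) → (EuclideanSpace ℝ (Fin 3) →L[ℝ] EuclideanSpace ℝ (Fin 4))),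
          HasWeakFDerivOn ⟨{x : EuclideanSpace ℝ (Fin 3) | ∀ i : Fin 3, |x i| < 1}, hQ⟩ volume W GW →
          (∀ x : EuclideanSpace ℝ (Fin 3), (∀ i : Fin 3, |x i| < 1) → ‖W x‖ = 1) →
          IntegrableOn (fun x => ∑ i : Fin 3, ‖GW x (EuclideanSpace.single i (1:ℝ))‖ ^ 2) {x : EuclideanSpace ℝ (Fin 3) | ∀ i : Fin 3, |x i| < 1} →
          (∃ ρ' : ℝ, ρ' < ρ ∧ ∀ x : EuclideanSpace ℝ (Fin 3), x ∉ ball y ρ' → W x = U x) →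
          ∫ x in ball y ρ, ∑ i : Fin 3, ‖G x (EuclideanSpace.single i (1:ℝ))‖ ^ 2 ≤ ∫ x in ball y ρ, ∑ i : Fin 3, ‖GW x (EuclideanSpace.single i (1:ℝ))‖ ^ 2)) →
      ∀ η : ℝ, 0 < η → ∃ ρ : ℝ, 0 < ρ ∧ ρ < 1 ∧
        ρ⁻¹ * ∫ x in ball (0 : EuclideanSpace ℝ (Fin 3)) ρ, ∑ i : Fin 3, ‖G x (EuclideanSpace.single i (1:ℝ))‖ ^ 2 ≤ η :=
  zeroDensity_of_compactness_tangentMaps hC hT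

/-- ★★★ **THE REGISTERED S1″ TEXT FROM COMPACTNESS AND THE TANGENT-MAP LIOUVILLE ROW** (v1.4-band
`stub_uniformSmallScaleEnergy`, VERBATIM): uniform small-scale energy decay `∫_{Q_r} Σᵢ‖G eᵢ‖² ≤ ε·r` for `r ≤ r₁(Λ, ε)`,
for every cube-minimiser of energy `≤ Λ ≤ 21`, from the two named facts. [cite: Simon1996, §2.9 Lemma 1;
SchoenUhlenbeck1984, Proposition 1.2 (p. 90)] -/
theorem uniformSmallScaleEnergy_band_of_compactness_tangentMapFact (hC : Literature.Analysis.PDE.MinimisingMapCompactness)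
    (hT : Literature.Analysis.PDE.MinimisingTangentMapConstant) :
    ∀ (Λ ε : ℝ), 0 < Λ → Λ ≤ 21 → 0 < ε → ∃ r₁ : ℝ, 0 < r₁ ∧ r₁ ≤ 1 / 8 ∧
      ∀ (hQ : IsOpen {x : EuclideanSpace ℝ (Fin 3) | ∀ i : Fin 3, |x i| < 1}) (U : EuclideanSpace ℝ (Fin 3) → EuclideanSpace ℝ (Fin 4)) (G : EuclideanSpace ℝ (Fin 3) → (EuclideanSpace ℝ (Fin 3) →L[ℝ] EuclideanSpace ℝ (Fin 4))),
      Literature.Analysis.FunctionSpaces.HasWeakFDerivOn ⟨{x : EuclideanSpace ℝ (Fin 3) | ∀ i : Fin 3, |x i| < 1}, hQ⟩ volume U G →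
      (∀ x : EuclideanSpace ℝ (Fin 3), (∀ i : Fin 3, |x i| < 1) → ‖U x‖ = 1) →
      MeasureTheory.IntegrableOn (fun x => ∑ i : Fin 3, ‖G x (EuclideanSpace.single i (1:ℝ))‖ ^ 2)
        {x : EuclideanSpace ℝ (Fin 3) | ∀ i : Fin 3, |x i| < 1} →
      (∀ (V : EuclideanSpace ℝ (Fin 3) → EuclideanSpace ℝ (Fin 4)) (GV : EuclideanSpace ℝ (Fin 3) → (EuclideanSpace ℝ (Fin 3) →L[ℝ] EuclideanSpace ℝ (Fin 4))) (s : ℝ), s < 1 →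
        Literature.Analysis.FunctionSpaces.HasWeakFDerivOn ⟨{x : EuclideanSpace ℝ (Fin 3) | ∀ i : Fin 3, |x i| < 1}, hQ⟩ volume V GV →
        (∀ x : EuclideanSpace ℝ (Fin 3), (∀ i : Fin 3, |x i| < 1) → ‖V x‖ = 1) →
        MeasureTheory.IntegrableOn (fun x => ∑ i : Fin 3, ‖GV x (EuclideanSpace.single i (1:ℝ))‖ ^ 2)
        {x : EuclideanSpace ℝ (Fin 3) | ∀ i : Fin 3, |x i| < 1} →
        (∀ x : EuclideanSpace ℝ (Fin 3), (∃ i : Fin 3, s ≤ |x i|) → V x = U x) →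
        ∫ x in {x : EuclideanSpace ℝ (Fin 3) | ∀ i : Fin 3, |x i| < 1}, ∑ i : Fin 3, ‖G x (EuclideanSpace.single i (1:ℝ))‖ ^ 2 ≤
          ∫ x in {x : EuclideanSpace ℝ (Fin 3) | ∀ i : Fin 3, |x i| < 1}, ∑ i : Fin 3, ‖GV x (EuclideanSpace.single i (1:ℝ))‖ ^ 2) →
      ∫ x in {x : EuclideanSpace ℝ (Fin 3) | ∀ i : Fin 3, |x i| < 1}, ∑ i : Fin 3, ‖G x (EuclideanSpace.single i (1:ℝ))‖ ^ 2 ≤ Λ →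
      ∀ r : ℝ, 0 < r → r ≤ r₁ →
        ∫ x in {x : EuclideanSpace ℝ (Fin 3) | ∀ i : Fin 3, |x i| < r}, ∑ i : Fin 3, ‖G x (EuclideanSpace.single i (1:ℝ))‖ ^ 2 ≤ ε * r :=
  uniformSmallScaleEnergy_band_of_compactness_tangentMaps hC hT

end Summit.QuantumFields.YangMills.Theorems.PoincareLipschitzUniformSmallScaleEnergyOfTangentMapFact

end
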